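import Mathlib
import Literature.MathematicalPhysics.KineticTheory.HardSphereEuler
import Literature.Analysis.FunctionSpaces.TorusHolderBridge
import Literature.Analysis.FunctionSpaces.TorusCalculusProofs
import HarnessLib

/-!
# Crux `NearConstantShortTimeHL` (stmt-AtomisticToContinuum-12502), line `small-tilt-domination`:
# stubs `abs_sub_le_of_partialDeriv_le`, `norm_sub_le_of_partialDeriv_le`

Lipschitz bounds from gradient bounds on the flat torus `𝕋³ = UnitAddTorus (Fin 3)` for its
intrinsic (sup / product) metric: a smooth `f : 𝕋³ → F` with `‖∂ᵢ f‖ ≤ Λ` for the three coordinate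
directions satisfies `‖f x - f y‖ ≤ 3 Λ dist x y` (lead c3, wave 2; these feed the `M · dist x y`
hypotheses of `MesoscaleSuperlinearityE` with Euler profiles).

Route (folklore): take good lifts `a, b ∈ ℝ³` of `x, y` with `|aᵢ - bᵢ| ≤ dist x y`
(`Torus.exists_lift_forall_abs_sub_le_dist`), and apply the one-variable mean value inequality to
`t ↦ (lift f) (b + t (a - b))` on `[0, 1]`, whose derivative is
`D(lift f)(·)(a - b) = ∑ᵢ (a - b)ᵢ ∂ᵢ f (·)` (`Torus.fderiv_lift`,
`Torus.fderiv_apply_eq_sum_partialDeriv`), of norm `≤ ∑ᵢ |aᵢ - bᵢ| Λ ≤ 3 Λ dist x y`.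

No definitions, no named facts.
-/

noncomputable section

namespace Summit.AtomisticToContinuum.HydrodynamicLimit.Theorems.NearConstantShortTimeHL

open scoped BigOperators ENNReal
open MeasureTheory Set Filter
open Literature.MathematicalPhysics.KineticTheory Literature.Analysis.FluidPDE Literature.Analysis.FunctionSpaces

/-- **Lipschitz bound from partial derivatives on `𝕋³`, sup metric, any normed target.** A smooth
`f : 𝕋³ → F` with `‖∂ᵢ f‖ ≤ Λ` satisfies `‖f x - f y‖ ≤ 3 Λ dist x y` (mean value inequality along
the segment between coordinatewise good lifts). [folklore] -/
theorem we_norm_sub_le_of_norm_partialDeriv_le {F' : Type*} [NormedAddCommGroup F']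
    [NormedSpace ℝ F'] {f : T3 → F'} (hf : Torus.IsSmooth f) {Λ : ℝ}
    (hΛ : ∀ i x, ‖Torus.partialDeriv i f x‖ ≤ Λ) (x y : T3) : ‖f x - f y‖ ≤ 3 * Λ * dist x y := by
  obtain ⟨a, b, rfl, rfl, hab⟩ := Torus.exists_lift_forall_abs_sub_le_dist x y
  have h1 : Torus.IsContDiff 1 f := hf.isContDiff (by simp)
  -- the derivative of the lift along the segment from `b` to `a`
  have hderiv : ∀ t : ℝ, HasDerivAt (fun t : ℝ => Torus.lift f (b + t • (a - b)))
      (fderiv ℝ (Torus.lift f) (b + t • (a - b)) (a - b)) t := by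
    intro t
    have hl : HasFDerivAt (Torus.lift f) (fderiv ℝ (Torus.lift f) (b + t • (a - b)))
        (b + t • (a - b)) :=
      ((h1.differentiable one_ne_zero) _).hasFDerivAt
    have hp : HasDerivAt (fun t : ℝ => b + t • (a - b)) (a - b) t := by
      simpa using ((hasDerivAt_id t).smul_const (a - b)).const_add b
    exact hl.comp_hasDerivAt t hp
  -- its norm is at most `3 Λ dist x y`
  have hbound : ∀ t ∈ Ico (0 : ℝ) 1,
      ‖fderiv ℝ (Torus.lift f) (b + t • (a - b)) (a - b)‖ ≤
        3 * Λ * dist (Torus.proj a) (Torus.proj b) := by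
    intro t _
    rw [Torus.fderiv_lift, Torus.fderiv_apply_eq_sum_partialDeriv h1]
    calc ‖∑ i, (a - b) i • Torus.partialDeriv i f (Torus.proj (b + t • (a - b)))‖
        ≤ ∑ i, ‖(a - b) i • Torus.partialDeriv i f (Torus.proj (b + t • (a - b)))‖ :=
          norm_sum_le _ _
      _ ≤ ∑ _i : Fin 3, dist (Torus.proj a) (Torus.proj b) * Λ :=
          Finset.sum_le_sum fun i _ => by
            rw [norm_smul, Real.norm_eq_abs, PiLp.sub_apply]
            exact mul_le_mul (hab i) (hΛ i _) (norm_nonneg _) dist_nonneg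
      _ = 3 * Λ * dist (Torus.proj a) (Torus.proj b) := by
          simp only [Finset.sum_const, Finset.card_univ, Fintype.card_fin, nsmul_eq_mul]
          push_cast
          ring
  have h := norm_image_sub_le_of_norm_deriv_le_segment_01'
    (fun t _ => (hderiv t).hasDerivWithinAt) hbound
  simpa using h

/-- **Registered stub `abs_sub_le_of_partialDeriv_le`.** A smooth scalar `f : 𝕋³ → ℝ` with
`|∂ᵢ f| ≤ Λ` is `3Λ`-Lipschitz for the sup metric of `𝕋³`: `|f x - f y| ≤ 3 Λ dist x y`.
[folklore] -/
theorem abs_sub_le_of_partialDeriv_le : ∀ {f : T3 → ℝ}, Torus.IsSmooth f → ∀ {Λ : ℝ}, (∀ i x, |Torus.partialDeriv i f x| ≤ Λ) → ∀ x y : T3, |f x - f y| ≤ 3 * Λ * dist x y := by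
  intro f hf Λ hΛ x y
  rw [← Real.norm_eq_abs]
  exact we_norm_sub_le_of_norm_partialDeriv_le hf (fun i x => (Real.norm_eq_abs _).le.trans (hΛ i x)) x y

/-- **Registered stub `norm_sub_le_of_partialDeriv_le`.** A smooth vector field `f : 𝕋³ → ℝ³`
with `‖∂ᵢ f‖ ≤ Λ` is `3Λ`-Lipschitz for the sup metric of `𝕋³`: `‖f x - f y‖ ≤ 3 Λ dist x y`
(vector-valued mean value inequality, no loss through coordinates). [folklore] -/
theorem norm_sub_le_of_partialDeriv_le : ∀ {f : T3 → V3}, Torus.IsSmooth f → ∀ {Λ : ℝ}, (∀ i x, ‖Torus.partialDeriv i f x‖ ≤ Λ) → ∀ x y : T3, ‖f x - f y‖ ≤ 3 * Λ * dist x y := by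
  intro f hf Λ hΛ x y
  exact we_norm_sub_le_of_norm_partialDeriv_le hf hΛ x y

end Summit.AtomisticToContinuum.HydrodynamicLimit.Theorems.NearConstantShortTimeHL

end
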